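import Summits.ResolutionOfSingularities.ResolutionOfSingularities.Theorems.FrobeniusLadderFInjectiveMacaulayficationCNConeFiModelRelBlowup
import Summits.ResolutionOfSingularities.ResolutionOfSingularities.Theorems.FrobeniusLadderFInjectiveMacaulayficationBlowupAlgebraLocalization
import HarnessLib

/-!
# Local rings of the affine blow-up algebras `R[I/a]` and of their localizations `R_𝔭[I R_𝔭/a]` are stalks of `Bl_I`
# (crux `FInjectiveMacaulayfication` stmt-ResolutionOfSingularities-15315, chain w45a; T-𝒫-loc §5 / 5d «P_cert ⇒ P_loc»,
# `L/w45a/ClassGlueSig.lean` v3 `74b6a04e74c75940`; owner res-D-pv-017 AS res-L1-w45a-stub-5)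

Support file for crux stmt-ResolutionOfSingularities-15315 (`FrobeniusLadder.FInjectiveMacaulayfication`), chain w45a.
[OURS · L1 W4.5a] — NOT a statement of any manuscript; AI-written, weaker than expert review.

The RING-LOCAL READING behind `P_loc` (ClassGlueSig v3 §5): for `a ∈ I ⊆ R`,
* `exists_affineBlowup_stalk_ringEquiv`: every local ring `R[I/a]_q` of the affine blow-up algebra is a stalk of
  `affineBlowup I = Proj R[It]` (the chart `D₊(at) = Spec (R[It])_{(at)} ≅ Spec R[I/a]`, `reesChartEquiv`, `Proj.awayι`);
* `atPrime_fiClause_of_cover`: hence E6‴ cover certificates for `(R, I, v)` plus the clause off `V(I)` give the FULL clause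
  (domain ∧ Cohen–Macaulay ∧ Frobenius-closed parameter ideals) at EVERY local ring of EVERY chart `R[I/a]`, `a ∈ I`
  (`CNConeFiModelRelBlowup.affineBlowup_fiClause_of_cover`, p498340);
* `atPrime_fiClause_localization`: and the same at every local ring of every chart `R'[IR'/a]` of the base change to a
  localization `R' = M⁻¹R` (e.g. `R' = 𝒪_{X,b} = Γ(U)_{𝔭_b}`), through `R'[IR'/a]_{Q'} ≅ R[I/a]_{ψ⁻¹Q'}`
  (`BlowupAlgebraLocalization.nonempty_ringEquiv_atPrime_comap`, p508642).
This is the algebra of 5d `stub_certifiedChart_pointFixable` (P_cert ⇒ P_loc). No definitions, no named facts. [folklore]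
-/

-- single-problem summit: the doubled namespace component is forced
set_option linter.dupNamespace false

noncomputable section

open AlgebraicGeometry CategoryTheory Literature.AlgebraicGeometry.Resolution

namespace Summit.ResolutionOfSingularities.ResolutionOfSingularities.Theorems.FInjectiveMacaulayfication.BlowupAlgebraLocalRings

open Summit.ResolutionOfSingularities.ResolutionOfSingularities.Theorems.FInjectiveMacaulayfication

/-- **Every local ring of `R[I/a]`, `a ∈ I`, is a stalk of `Bl_I(R)`**: for a prime `q` of the affine blow-up algebra there is
a point `y` of the chart `D₊(at) ⊆ affineBlowup I` with `𝒪_{Bl,y} ≅ R[I/a]_q` (`Proj.awayι` is an open immersion onto `D₊(at)`,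
`Spec.stalkIso`, and `reesChartEquiv : (R[It])_{(at)} ≅ R[I/a]`). [cite: StacksProject, Tag 0804] -/
theorem exists_affineBlowup_stalk_ringEquiv {R : Type} [CommRing R] {I : Ideal R} (a : R) (ha : a ∈ I)
    (q : Ideal (blowupAlgebra I a)) [q.IsPrime] :
    ∃ y : ↥(affineBlowup I), y ∈ Proj.basicOpen (reesGrading I) (reesT a ha) ∧
      Nonempty (((affineBlowup I).presheaf.stalk y) ≃+* Localization.AtPrime q) := by
  let q₁ : PrimeSpectrum (HomogeneousLocalization.Away (reesGrading I) (reesT a ha)) :=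
    ⟨q.comap (reesChartEquiv a ha).toRingHom, inferInstance⟩
  obtain ⟨e₂⟩ := BlowupFiModelOfCover.nonempty_ringEquiv_localization_of_ringEquiv (reesChartEquiv a ha) q₁.asIdeal q
    fun x => Iff.rfl
  refine ⟨(Proj.awayι (reesGrading I) (reesT a ha) (reesT_mem a ha) Nat.one_pos).base q₁, ?_, ⟨?_⟩⟩
  · rw [← Proj.opensRange_awayι (reesGrading I) (reesT a ha) (reesT_mem a ha) Nat.one_pos]
    exact Scheme.Hom.mem_opensRange.mpr ⟨q₁, rfl⟩
  · exact (((asIso ((Proj.awayι (reesGrading I) (reesT a ha) (reesT_mem a ha) Nat.one_pos).stalkMap q₁)).commRingCatIsoToRingEquiv).trans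
      (Spec.stalkIso (.of (HomogeneousLocalization.Away (reesGrading I) (reesT a ha))) q₁).commRingCatIsoToRingEquiv).trans e₂

/-- **The full clause at every local ring of every chart `R[I/a]`** from E6‴ data: `R` a Noetherian domain of characteristic `p`,
`I ≠ 0`, non-zero `v_j ∈ I` whose Rees charts cover `Bl_I` and whose blow-up algebras satisfy the Cohen–Macaulay + Frobenius-closed
clause at their maximal ideals containing `v_j/1`, and the full clause at the primes of `R` off `V(I)`; then for every `a ∈ I` and
every prime `q` of `R[I/a]`, `R[I/a]_q` is a domain satisfying the clause (it is a stalk of `Bl_I`, where p498340 applies).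
[folklore] -/
theorem atPrime_fiClause_of_cover (p : ℕ) [Fact p.Prime] (R : Type) [CommRing R] [IsDomain R] [IsNoetherianRing R]
    [CharP R p] (I : Ideal R) (t : ℕ) (v : Fin t → R) (hv : ∀ j : Fin t, v j ∈ I) (hI : I ≠ ⊥) (hv0 : ∀ j : Fin t, v j ≠ 0)
    (hcov : (HomogeneousIdeal.irrelevant (reesGrading I)).toIdeal ≤
      (Ideal.span (Set.range fun j : Fin t => reesT (I := I) (v j) (hv j))).radical)
    (hoff : ∀ (P : Ideal R) [P.IsPrime], ¬ I ≤ P →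
      IsDomain (Localization.AtPrime P) ∧
      ∀ d : ℕ, ringKrullDim (Localization.AtPrime P) = d → ∀ s : Fin d → Localization.AtPrime P,
        (Ideal.span (Set.range s)).radical.IsMaximal →
          RingTheory.Sequence.IsWeaklyRegular (Localization.AtPrime P) (List.ofFn s) ∧
          ∀ y : Localization.AtPrime P, (∃ e : ℕ, y ^ p ^ e ∈ Ideal.span
            ((fun z : Localization.AtPrime P => z ^ p ^ e) ''
              (Ideal.span (Set.range s) : Set (Localization.AtPrime P)))) → y ∈ Ideal.span (Set.range s))
    (hon : ∀ (j : Fin t) (Q : Ideal (blowupAlgebra I (v j))) [Q.IsMaximal],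
      algebraMap R (blowupAlgebra I (v j)) (v j) ∈ Q →
      ∀ d : ℕ, ringKrullDim (Localization.AtPrime Q) = d → ∀ s : Fin d → Localization.AtPrime Q,
        (Ideal.span (Set.range s)).radical.IsMaximal →
          RingTheory.Sequence.IsWeaklyRegular (Localization.AtPrime Q) (List.ofFn s) ∧
          ∀ y : Localization.AtPrime Q, (∃ e : ℕ, y ^ p ^ e ∈ Ideal.span
            ((fun z : Localization.AtPrime Q => z ^ p ^ e) ''
              (Ideal.span (Set.range s) : Set (Localization.AtPrime Q)))) → y ∈ Ideal.span (Set.range s))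
    (a : R) (ha : a ∈ I) (q : Ideal (blowupAlgebra I a)) [q.IsPrime] :
    IsDomain (Localization.AtPrime q) ∧
      ∀ d : ℕ, ringKrullDim (Localization.AtPrime q) = d → ∀ s : Fin d → Localization.AtPrime q,
        (Ideal.span (Set.range s)).radical.IsMaximal →
          RingTheory.Sequence.IsWeaklyRegular (Localization.AtPrime q) (List.ofFn s) ∧
          ∀ y : Localization.AtPrime q, (∃ e : ℕ, y ^ p ^ e ∈ Ideal.span
            ((fun z : Localization.AtPrime q => z ^ p ^ e) ''
              (Ideal.span (Set.range s) : Set (Localization.AtPrime q)))) → y ∈ Ideal.span (Set.range s) := by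
  obtain ⟨y, -, ⟨e⟩⟩ := exists_affineBlowup_stalk_ringEquiv a ha q
  obtain ⟨hdom, hcl⟩ := CNConeFiModelRelBlowup.affineBlowup_fiClause_of_cover p R I t v hv hI hv0 hcov hoff hon y
  haveI := hdom
  exact ⟨MulEquiv.isDomain ((affineBlowup I).presheaf.stalk y) e.symm.toMulEquiv,
    DegreeZeroDescent.inlineClause_of_ringEquiv (L' := Localization.AtPrime q) p e hcl⟩

/-- **The full clause at every local ring of every chart of the LOCALIZED blow-up algebra** `R'[I'R'/a']`, `R' = M⁻¹R` with
`R → R'` injective, `I' = IR'`, `a' = a/1`, `a ∈ I`: from the same E6‴ data over `R`, through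
`R'[I'/a']_{Q'} ≅ R[I/a]_{ψ⁻¹Q'}` (p508642). With `M = 𝔭_b.primeCompl`, `R' = 𝒪_{X,b}`, this is the `P_loc` clause of ClassGlueSig v3 §5 at
ALL primes of ALL charts `𝒪_b[(c)/c_j]` of a generating tuple `c` of `I𝒪_b`. [folklore] -/
theorem atPrime_fiClause_localization (p : ℕ) [Fact p.Prime] (R : Type) [CommRing R] [IsDomain R] [IsNoetherianRing R]
    [CharP R p] (I : Ideal R) (t : ℕ) (v : Fin t → R) (hv : ∀ j : Fin t, v j ∈ I) (hI : I ≠ ⊥) (hv0 : ∀ j : Fin t, v j ≠ 0)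
    (hcov : (HomogeneousIdeal.irrelevant (reesGrading I)).toIdeal ≤
      (Ideal.span (Set.range fun j : Fin t => reesT (I := I) (v j) (hv j))).radical)
    (hoff : ∀ (P : Ideal R) [P.IsPrime], ¬ I ≤ P →
      IsDomain (Localization.AtPrime P) ∧
      ∀ d : ℕ, ringKrullDim (Localization.AtPrime P) = d → ∀ s : Fin d → Localization.AtPrime P,
        (Ideal.span (Set.range s)).radical.IsMaximal →
          RingTheory.Sequence.IsWeaklyRegular (Localization.AtPrime P) (List.ofFn s) ∧
          ∀ y : Localization.AtPrime P, (∃ e : ℕ, y ^ p ^ e ∈ Ideal.span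
            ((fun z : Localization.AtPrime P => z ^ p ^ e) ''
              (Ideal.span (Set.range s) : Set (Localization.AtPrime P)))) → y ∈ Ideal.span (Set.range s))
    (hon : ∀ (j : Fin t) (Q : Ideal (blowupAlgebra I (v j))) [Q.IsMaximal],
      algebraMap R (blowupAlgebra I (v j)) (v j) ∈ Q →
      ∀ d : ℕ, ringKrullDim (Localization.AtPrime Q) = d → ∀ s : Fin d → Localization.AtPrime Q,
        (Ideal.span (Set.range s)).radical.IsMaximal →
          RingTheory.Sequence.IsWeaklyRegular (Localization.AtPrime Q) (List.ofFn s) ∧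
          ∀ y : Localization.AtPrime Q, (∃ e : ℕ, y ^ p ^ e ∈ Ideal.span
            ((fun z : Localization.AtPrime Q => z ^ p ^ e) ''
              (Ideal.span (Set.range s) : Set (Localization.AtPrime Q)))) → y ∈ Ideal.span (Set.range s))
    {R' : Type} [CommRing R'] [Algebra R R'] (M : Submonoid R) [IsLocalization M R']
    (hinj : Function.Injective (algebraMap R R')) (a : R) (ha : a ∈ I)
    {I' : Ideal R'} (hI' : I' = I.map (algebraMap R R')) {a' : R'} (ha' : a' = algebraMap R R' a)
    (Q' : Ideal (blowupAlgebra I' a')) [Q'.IsPrime] :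
    IsDomain (Localization.AtPrime Q') ∧
      ∀ d : ℕ, ringKrullDim (Localization.AtPrime Q') = d → ∀ s : Fin d → Localization.AtPrime Q',
        (Ideal.span (Set.range s)).radical.IsMaximal →
          RingTheory.Sequence.IsWeaklyRegular (Localization.AtPrime Q') (List.ofFn s) ∧
          ∀ y : Localization.AtPrime Q', (∃ e : ℕ, y ^ p ^ e ∈ Ideal.span
            ((fun z : Localization.AtPrime Q' => z ^ p ^ e) ''
              (Ideal.span (Set.range s) : Set (Localization.AtPrime Q')))) → y ∈ Ideal.span (Set.range s) := by
  subst hI' ha'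
  obtain ⟨ψ, hψ⟩ := BlowupAlgebraLocalization.exists_map I a (algebraMap R R')
  obtain ⟨e⟩ := BlowupAlgebraLocalization.nonempty_ringEquiv_atPrime_comap M hinj I a hψ Q'
  obtain ⟨hdom, hcl⟩ := atPrime_fiClause_of_cover p R I t v hv hI hv0 hcov hoff hon a ha (Q'.comap ψ)
  haveI := hdom
  exact ⟨MulEquiv.isDomain (Localization.AtPrime (Q'.comap ψ)) e.symm.toMulEquiv,
    DegreeZeroDescent.inlineClause_of_ringEquiv (L := Localization.AtPrime (Q'.comap ψ)) (L' := Localization.AtPrime Q') p e hcl⟩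

end Summit.ResolutionOfSingularities.ResolutionOfSingularities.Theorems.FInjectiveMacaulayfication.BlowupAlgebraLocalRings

end
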